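import Summits.CriticalPhenomena.PercolationContinuityZ3.Theorems.PercNearOneGluingNoHeavyLowerTailSahiCubePhi
import Summits.CriticalPhenomena.PercolationContinuityZ3.Theorems.PercNearOneGluingNoHeavyLowerTailSahiSharedTwoPoint
import Summits.CriticalPhenomena.PercolationContinuityZ3.Theorems.PercNearOneGluingNoHeavyLowerTailSahiTriangleClassT
import Literature.Combinatorics.Sahi2008.PushForward
import Mathlib.Tactic.Linarith
import Mathlib.Tactic.Ring
import HarnessLib

/-!
# `NoHeavyLowerTail` (crux stmt-CriticalPhenomena-4575), P2 — **THEOREM B: THE HYBRID CERTIFICATE GIVES SAHI'S `C_3` WHEN THE `f`–`g` BLOCK IS A CUBE**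

Memo SAHI-ROUTE.md §4.29(d), §4.31 / `G3-REDUCTIONS-PROOFS.md` (seat `prim-masterthm-p2`, gen 9; `--supports stmt-CriticalPhenomena-4575`).
No `sorry`, no named facts, standard axioms.

SETTING (as in `…SahiSharedTwoPointIdentity`).  `α, β` finite distributive lattices with FKG probability weights `wA, wB`; the block
shared by `f` and `g` is the CUBE `Finset ι` (`ι` finite) with a probability weight `wC` which is LOG-MODULAR,
`wC(x)wC(y) = wC(x ∩ y)wC(x ∪ y)` (every product Bernoulli weight); `f(c,a)`, `g(c,b)`, `h(c,a,b)` nonnegative and monotone in every argument.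
Notation `F = FC`, `Ȳ = Ybar`, `EH`, `Φ_r = PhiOf`, `Δ_r = DeltaOf` from the identity file.

* `PhiOf_nonneg_cube` — **`G3`**: for any ratio `r : Finset ι → [0,1]` with STAR `F(c') ≤ (1 − r_c + r_{c'})F(c)` (`c' ⊆ c`), the pointwise kernel
  `Φ_r(b) ≥ 0` for every `b` (orbit reduction + the `GF(2)` chain lemma, `SahiBox.phi_nonneg`).  This is the lemma that was missing in §4.29.
* `sahiE_three_nonneg_sharedCube_of_ratio` — **THEOREM B** (§4.29(d), now unconditional): if some `r ∈ [0,1]^γ` satisfies STAR and TOPHEAVY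
  (`Cov_{wC}(G_C, rȲ − EH·F) ≥ 0` for `G_C = E_b g(·,b)`), then `E_3(f,g,h) ≥ 0`.  Proof: the ratio identity
  `E_3 = E_b[Φ_r + Δ_r] + covpart_r` (`sahiE_three_eq_of_ratio`), `Φ_r ≥ 0` (G3), `E_bΔ_r = Cov_{wC}(G_C, rȲ − EH·F) ≥ 0` (TOPHEAVY), `covpart_r ≥ 0`
  (`covpart_nonneg_of_ratio`, FKG on `β`).
* `sahiE_three_nonneg_sharedCube_capped` — THEOREM B with the capped ratio `ρ = min(1, EH·F/Ȳ)`: `Cov_{wC}(G_C, (EH·F − Ȳ)⁺) ≤ 0`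
  suffices; `sahiE_three_nonneg_sharedCube_of_surplus` — **THEOREM B⁺, unconditional**: nonnegative surplus `EH·F ≤ Ȳ` pointwise (⊋ class T)
  ⇒ `E_3 ≥ 0`.
* `sahiE_three_nonneg_sharedSetCube_of_ratio`, `sahiE_three_nonneg_sharedSetCube_of_surplus` — the same on the Boolean lattice `Set ι` (e.g. `bernoulliWeight p`, log-modular by
  `BHK2006.weight_inter_mul_union`), transported along `Finset ι ≃ Set ι` with `sahiE_pushWeight`.
-/

noncomputable section

open scoped Classical

namespace Summit.CriticalPhenomena.PercolationContinuityZ3.Theorems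

namespace SahiBox

open Finset
open Literature.Combinatorics.Sahi2008
open SahiSharedTwoPoint (Y FC HH GG GC Ybar Hbar EH EF Gbar PhiOf DeltaOf psiOf rho psi)

section FinsetCube

variable {ι α β : Type} [DecidableEq ι] [Fintype ι] [Fintype α] [Fintype β]
  {wA : α → ℝ} {wB : β → ℝ} {wC : Finset ι → ℝ}
  {f : Finset ι → α → ℝ} {g : Finset ι → β → ℝ} {h : Finset ι → α → β → ℝ} {r : Finset ι → ℝ}

omit [Fintype β] in
/-- **`G3` on the cube**: for a log-modular probability weight `wC` on `Finset ι`, a ratio `r ∈ [0,1]` with STAR, and `f, g, h ≥ 0` monotone in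
every argument (FKG on `α`), the pointwise kernel `Φ_r(b)` of the ratio identity is nonnegative for every `b`. [this work] -/
theorem PhiOf_nonneg_cube [DistribLattice α] (hA : IsFKGMeasure wA) (hC0 : ∀ c, 0 ≤ wC c) (hC1 : ∑ c, wC c = 1)
    (hCmod : ∀ x y, wC x * wC y = wC (x ∩ y) * wC (x ∪ y))
    (hf0 : ∀ c a, 0 ≤ f c a) (hfa : ∀ c, Monotone (f c)) (hfc : ∀ a, Monotone (fun c => f c a))
    (hg0 : ∀ c b, 0 ≤ g c b) (hgc : ∀ b, Monotone (fun c => g c b))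
    (hh0 : ∀ c a b, 0 ≤ h c a b) (hhc : ∀ a b, Monotone (fun c => h c a b)) (hha : ∀ c b, Monotone (fun a => h c a b))
    (hr0 : ∀ c, 0 ≤ r c) (hr1 : ∀ c, r c ≤ 1)
    (hstar : ∀ c c', c' ≤ c → FC wA f c' ≤ (1 - r c + r c') * FC wA f c) (b : β) :
    0 ≤ PhiOf wA wC f g h r b := by
  have hA0 := hA.nonneg
  unfold PhiOf EF GG
  refine phi_nonneg wC hC0 hC1 hCmod (F := FC wA f) (H := fun c => HH wA h c b) (Y := fun c => Y wA f h c b)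
    (g := fun c => g c b) ?_ ?_ ?_ ?_ ?_ ?_ hr0 hr1 hstar (fun c => hg0 c b) (hgc b)
  · exact fun c c' hcc => sum_le_sum fun a _ => mul_le_mul_of_nonneg_left (hfc a hcc) (hA0 a)
  · exact fun c => sum_nonneg fun a _ => mul_nonneg (hA0 a) (hf0 c a)
  · exact fun c c' hcc => sum_le_sum fun a _ => mul_le_mul_of_nonneg_left (hhc a b hcc) (hA0 a)
  · exact fun c => sum_nonneg fun a _ => mul_nonneg (hA0 a) (hh0 c a b)
  · exact fun c c' hcc => sum_le_sum fun a _ => mul_le_mul_of_nonneg_left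
      (mul_le_mul (hfc a hcc) (hhc a b hcc) (hh0 c a b) (hf0 c' a)) (hA0 a)
  · exact fun c => SahiSharedTwoPoint.FH_le_Y hA hf0 hh0 hfa hha c b

/-- **THEOREM B (hybrid certificate, cubes).**  `α, β` finite distributive lattices with FKG probability weights; the block shared by `f` and `g`
is the cube `Finset ι` with a log-modular probability weight `wC`; `f(c,a)`, `g(c,b)`, `h(c,a,b) ≥ 0` monotone in every argument.  If some
`r : Finset ι → [0,1]` satisfies STAR `F(c') ≤ (1 − r_c + r_{c'})F(c)` (`c' ⊆ c`, `F = E_a f`) and TOPHEAVY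
`Cov_{wC}(G_C, rȲ − EH·F) ≥ 0` for the increasing function `G_C = E_b g(·,b)` (implied by top-heaviness against every up-set),
then `E_3(f,g,h) ≥ 0` under `wA ⊗ wB ⊗ wC`.  SAHI-ROUTE §4.29(d); the Φ-part is `G3`
(`PhiOf_nonneg_cube`), proved via the `GF(2)` chain lemma. [this work] -/
theorem sahiE_three_nonneg_sharedCube_of_ratio [DistribLattice α] [DistribLattice β]
    (hA : IsFKGMeasure wA) (hB : IsFKGMeasure wB) (hC0 : ∀ c, 0 ≤ wC c) (hC1 : ∑ c, wC c = 1)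
    (hCmod : ∀ x y, wC x * wC y = wC (x ∩ y) * wC (x ∪ y))
    (hf0 : ∀ c a, 0 ≤ f c a) (hfa : ∀ c, Monotone (f c)) (hfc : ∀ a, Monotone (fun c => f c a))
    (hg0 : ∀ c b, 0 ≤ g c b) (hgb : ∀ c, Monotone (g c)) (hgc : ∀ b, Monotone (fun c => g c b))
    (hh0 : ∀ c a b, 0 ≤ h c a b) (hhc : ∀ a b, Monotone (fun c => h c a b))
    (hha : ∀ c b, Monotone (fun a => h c a b)) (hhb : ∀ c a, Monotone (h c a))
    (r : Finset ι → ℝ) (hr0 : ∀ c, 0 ≤ r c) (hr1 : ∀ c, r c ≤ 1)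
    (hstar : ∀ c c', c' ≤ c → FC wA f c' ≤ (1 - r c + r c') * FC wA f c)
    (htop : (∑ c, wC c * GC wB g c) * (∑ c, wC c * (r c * Ybar wA wB f h c - EH wA wB wC h * FC wA f c)) ≤
        ∑ c, wC c * (GC wB g c * (r c * Ybar wA wB f h c - EH wA wB wC h * FC wA f c))) :
    0 ≤ sahiE (fun q : α × β × Finset ι => wA q.1 * wB q.2.1 * wC q.2.2) 3
        ![fun q => f q.2.2 q.1, fun q => g q.2.2 q.2.1, fun q => h q.2.2 q.1 q.2.1] := by
  have hB0 := hB.nonneg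
  rw [SahiSharedTwoPoint.sahiE_three_eq_of_ratio r hA.sum_eq_one hB.sum_eq_one]
  have hcov := SahiSharedTwoPoint.covpart_nonneg_of_ratio (r := r) hA hB hC0 hf0 hg0 hgb hh0 hhb hr0 hr1
  refine add_nonneg ?_ hcov
  simp only [mul_add, sum_add_distrib]
  refine add_nonneg (sum_nonneg fun b _ => mul_nonneg (hB0 b)
    (PhiOf_nonneg_cube hA hC0 hC1 hCmod hf0 hfa hfc hg0 hgc hh0 hhc hha hr0 hr1 hstar b)) ?_
  -- `Σ_b wB Δ_r(b) = Cov_{wC}(G_C, rȲ − EH·F) ≥ 0` by TOPHEAVY applied to the increasing `G_C = E_b g`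
  have hΔ : (∑ b, wB b * DeltaOf wA wB wC f g h r b) =
      Gbar wB wC g * (∑ c, wC c * psiOf wA wB wC f h r c) - ∑ c, wC c * (GC wB g c * psiOf wA wB wC f h r c) := by
    unfold DeltaOf
    simp only [mul_sub, sum_sub_distrib]
    congr 1
    · unfold Gbar; rw [sum_mul]; exact sum_congr rfl fun b _ => by ring
    · rw [SahiTriangleClassT.swap_bc wB wC (fun b c => g c b * psiOf wA wB wC f h r c)]
      refine sum_congr rfl fun c _ => ?_
      unfold GC; rw [SahiTriangleClassT.pull wB (psiOf wA wB wC f h r c) (g c)]; ring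
  rw [hΔ]
  have hGbar : Gbar wB wC g = ∑ c, wC c * GC wB g c := by
    unfold Gbar GG GC; exact SahiTriangleClassT.swap_bc wB wC (fun b c => g c b)
  have hψ : ∀ c, psiOf wA wB wC f h r c = -(r c * Ybar wA wB f h c - EH wA wB wC h * FC wA f c) := by
    intro c; unfold psiOf; ring
  simp only [hψ, hGbar, mul_neg, sum_neg_distrib]
  linarith


/-- **THEOREM B with the capped ratio** `ρ = min(1, EH·F/Ȳ)` (`SahiSharedTwoPoint.rho`, STAR by `SahiSharedTwoPoint.star`): on a cube with a log-modular
probability weight, `E_3(f,g,h) ≥ 0` as soon as the defect `ψ = (EH·F − Ȳ)⁺` is negatively correlated with `G_C = E_b g(·,b)`: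
`E_{wC}[G_C ψ] ≤ E_{wC}[G_C]·E_{wC}[ψ]` (e.g. if `Cov_{wC}(1_U, ψ) ≤ 0` for every up-set `U`).  SAHI-ROUTE §4.29(d). [this work] -/
theorem sahiE_three_nonneg_sharedCube_capped [DistribLattice α] [DistribLattice β]
    (hA : IsFKGMeasure wA) (hB : IsFKGMeasure wB) (hC0 : ∀ c, 0 ≤ wC c) (hC1 : ∑ c, wC c = 1)
    (hCmod : ∀ x y, wC x * wC y = wC (x ∩ y) * wC (x ∪ y))
    (hf0 : ∀ c a, 0 ≤ f c a) (hfa : ∀ c, Monotone (f c)) (hfc : ∀ a, Monotone (fun c => f c a))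
    (hg0 : ∀ c b, 0 ≤ g c b) (hgb : ∀ c, Monotone (g c)) (hgc : ∀ b, Monotone (fun c => g c b))
    (hh0 : ∀ c a b, 0 ≤ h c a b) (hhc : ∀ a b, Monotone (fun c => h c a b))
    (hha : ∀ c b, Monotone (fun a => h c a b)) (hhb : ∀ c a, Monotone (h c a))
    (htop : ∑ c, wC c * (GC wB g c * psi wA wB wC f h c) ≤ (∑ c, wC c * GC wB g c) * (∑ c, wC c * psi wA wB wC f h c)) :
    0 ≤ sahiE (fun q : α × β × Finset ι => wA q.1 * wB q.2.1 * wC q.2.2) 3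
        ![fun q => f q.2.2 q.1, fun q => g q.2.2 q.2.1, fun q => h q.2.2 q.1 q.2.1] := by
  have hA0 := hA.nonneg
  have hB0 := hB.nonneg
  refine sahiE_three_nonneg_sharedCube_of_ratio hA hB hC0 hC1 hCmod hf0 hfa hfc hg0 hgb hgc hh0 hhc hha hhb
    (rho wA wB wC f h) (fun c => (SahiSharedTwoPoint.rho_spec hA0 hB0 hC0 hf0 hh0 c).1)
    (fun c => (SahiSharedTwoPoint.rho_spec hA0 hB0 hC0 hf0 hh0 c).2.1)
    (fun c c' hcc => SahiSharedTwoPoint.star hA0 hB0 hC0 hf0 hfc hh0 hhc hcc) ?_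
  have hψ : ∀ c, rho wA wB wC f h c * Ybar wA wB f h c - EH wA wB wC h * FC wA f c = -psi wA wB wC f h c := by
    intro c; unfold psi; ring
  simp only [hψ, mul_neg, sum_neg_distrib]
  linarith [htop]

/-- **THEOREM B⁺ (unconditional class: NONNEGATIVE SURPLUS).**  On a cube with a log-modular probability weight, if the surplus is nonnegative,
`EH·F(c) ≤ Ȳ(c)` for every `c` (this contains class T, where `h` does not depend on `c`, by FKG on `α`), then `E_3(f,g,h) ≥ 0` for all
`f(c,a), g(c,b), h(c,a,b) ≥ 0` monotone.  (Capped ratio: `ψ ≡ 0`, so TOPHEAVY is void.) [this work] -/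
theorem sahiE_three_nonneg_sharedCube_of_surplus [DistribLattice α] [DistribLattice β]
    (hA : IsFKGMeasure wA) (hB : IsFKGMeasure wB) (hC0 : ∀ c, 0 ≤ wC c) (hC1 : ∑ c, wC c = 1)
    (hCmod : ∀ x y, wC x * wC y = wC (x ∩ y) * wC (x ∪ y))
    (hf0 : ∀ c a, 0 ≤ f c a) (hfa : ∀ c, Monotone (f c)) (hfc : ∀ a, Monotone (fun c => f c a))
    (hg0 : ∀ c b, 0 ≤ g c b) (hgb : ∀ c, Monotone (g c)) (hgc : ∀ b, Monotone (fun c => g c b))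
    (hh0 : ∀ c a b, 0 ≤ h c a b) (hhc : ∀ a b, Monotone (fun c => h c a b))
    (hha : ∀ c b, Monotone (fun a => h c a b)) (hhb : ∀ c a, Monotone (h c a))
    (hsur : ∀ c, EH wA wB wC h * FC wA f c ≤ Ybar wA wB f h c) :
    0 ≤ sahiE (fun q : α × β × Finset ι => wA q.1 * wB q.2.1 * wC q.2.2) 3
        ![fun q => f q.2.2 q.1, fun q => g q.2.2 q.2.1, fun q => h q.2.2 q.1 q.2.1] := by
  have hψ0 : ∀ c, psi wA wB wC f h c = 0 := fun c =>
    (SahiSharedTwoPoint.rho_spec hA.nonneg hB.nonneg hC0 hf0 hh0 c).2.2.2.2.2.1 (hsur c)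
  refine sahiE_three_nonneg_sharedCube_capped hA hB hC0 hC1 hCmod hf0 hfa hfc hg0 hgb hgc hh0 hhc hha hhb ?_
  simp only [hψ0, mul_zero, sum_const_zero, le_refl]

end FinsetCube

/-! ## Transfer to the Boolean lattice `Set ι` -/

section SetCube

variable {κ α' β' : Type} [Fintype κ] [Fintype α'] [Fintype β']
  {wA : α' → ℝ} {wB : β' → ℝ} {W : Set κ → ℝ}
  {f : Set κ → α' → ℝ} {g : Set κ → β' → ℝ} {h : Set κ → α' → β' → ℝ}

/-- **THEOREM B on `Set κ`.**  `α', β'` finite distributive lattices with FKG probability weights; the block shared by `f` and `g` is the Boolean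
lattice `Set κ` with a log-modular probability weight `W` (e.g. `bernoulliWeight p`); `f(c,a)`, `g(c,b)`, `h(c,a,b) ≥ 0` monotone in every argument.
If some `r : Set κ → [0,1]` satisfies STAR `F(c') ≤ (1 − r_c + r_{c'})F(c)` (`c' ⊆ c`) and TOPHEAVY `Cov_W(G_C, rȲ − EH·F) ≥ 0`
(`G_C = E_b g(·,b)`), then `E_3(f,g,h) ≥ 0` under `wA ⊗ wB ⊗ W`.  (Transfer of `sahiE_three_nonneg_sharedCube_of_ratio`.) [this work] -/
theorem sahiE_three_nonneg_sharedSetCube_of_ratio [DistribLattice α'] [DistribLattice β']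
    (hA : IsFKGMeasure wA) (hB : IsFKGMeasure wB) (hW0 : ∀ s, 0 ≤ W s) (hW1 : ∑ s, W s = 1)
    (hWmod : ∀ s t, W s * W t = W (s ∩ t) * W (s ∪ t))
    (hf0 : ∀ c a, 0 ≤ f c a) (hfa : ∀ c, Monotone (f c)) (hfc : ∀ a, Monotone (fun c => f c a))
    (hg0 : ∀ c b, 0 ≤ g c b) (hgb : ∀ c, Monotone (g c)) (hgc : ∀ b, Monotone (fun c => g c b))
    (hh0 : ∀ c a b, 0 ≤ h c a b) (hhc : ∀ a b, Monotone (fun c => h c a b))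
    (hha : ∀ c b, Monotone (fun a => h c a b)) (hhb : ∀ c a, Monotone (h c a))
    (r : Set κ → ℝ) (hr0 : ∀ c, 0 ≤ r c) (hr1 : ∀ c, r c ≤ 1)
    (hstar : ∀ c c', c' ≤ c → FC wA f c' ≤ (1 - r c + r c') * FC wA f c)
    (htop : (∑ c, W c * GC wB g c) * (∑ c, W c * (r c * Ybar wA wB f h c - EH wA wB W h * FC wA f c)) ≤
        ∑ c, W c * (GC wB g c * (r c * Ybar wA wB f h c - EH wA wB W h * FC wA f c))) :
    0 ≤ sahiE (fun q : α' × β' × Set κ => wA q.1 * wB q.2.1 * W q.2.2) 3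
        ![fun q => f q.2.2 q.1, fun q => g q.2.2 q.2.1, fun q => h q.2.2 q.1 q.2.1] := by
  set e : Finset κ ≃ Set κ := Fintype.finsetEquivSet
  have he : ∀ x : Finset κ, e x = (↑x : Set κ) := fun x => rfl
  have hemono : ∀ {x y : Finset κ}, x ⊆ y → e x ≤ e y := fun hxy => by
    rw [he, he]; exact Finset.coe_subset.2 hxy
  let E : α' × β' × Finset κ ≃ α' × β' × Set κ := (Equiv.refl α').prodCongr ((Equiv.refl β').prodCongr e)
  -- the weight on `α' × β' × Set κ` is the push-forward along `E` of the transported weight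
  have hpush : (fun q : α' × β' × Set κ => wA q.1 * wB q.2.1 * W q.2.2) =
      pushWeight (fun q : α' × β' × Finset κ => wA q.1 * wB q.2.1 * W (e q.2.2)) E := by
    funext q
    rw [pushWeight_equiv]
    simp [E]
  rw [hpush, sahiE_pushWeight]
  have hfun : (fun i => (![fun q : α' × β' × Set κ => f q.2.2 q.1, fun q => g q.2.2 q.2.1, fun q => h q.2.2 q.1 q.2.1] i) ∘ ⇑E) =
      ![fun q : α' × β' × Finset κ => f (e q.2.2) q.1, fun q => g (e q.2.2) q.2.1, fun q => h (e q.2.2) q.1 q.2.1] := by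
    funext i q
    fin_cases i <;> simp [E]
  rw [hfun]
  -- sums over `Set κ` are sums over `Finset κ` along `e`
  have hsum : ∀ φ : Set κ → ℝ, ∑ x : Finset κ, φ (e x) = ∑ s, φ s := fun φ => e.sum_comp φ
  have hEH : EH wA wB (fun x => W (e x)) (fun x a b => h (e x) a b) = EH wA wB W h := by
    unfold EH; exact hsum (fun s => W s * Hbar wA wB h s)
  refine sahiE_three_nonneg_sharedCube_of_ratio (wC := fun x => W (e x)) (f := fun x a => f (e x) a)
    (g := fun x b => g (e x) b) (h := fun x a b => h (e x) a b) hA hB (fun c => hW0 _) ?_ ?_ (fun c a => hf0 _ a)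
    (fun c => hfa _) (fun a x y hxy => hfc a (hemono hxy)) (fun c b => hg0 _ b) (fun c => hgb _)
    (fun b x y hxy => hgc b (hemono hxy)) (fun c a b => hh0 _ a b) (fun a b x y hxy => hhc a b (hemono hxy))
    (fun c b => hha _ b) (fun c a => hhb _ a) (fun x => r (e x)) (fun c => hr0 _) (fun c => hr1 _)
    (fun c c' hcc => hstar (e c) (e c') (hemono hcc)) ?_
  · rw [hsum (fun s => W s), hW1]
  · intro x y
    rw [hWmod, he, he, he, he, Finset.coe_inter, Finset.coe_union]
  · have ht := htop
    rw [← hsum (fun c => W c * GC wB g c), ← hsum (fun c => W c * (r c * Ybar wA wB f h c - EH wA wB W h * FC wA f c)),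
      ← hsum (fun c => W c * (GC wB g c * (r c * Ybar wA wB f h c - EH wA wB W h * FC wA f c)))] at ht
    rw [hEH]
    exact ht


/-- **THEOREM B⁺ on `Set κ`**: nonnegative surplus `EH·F ≤ Ȳ` pointwise ⇒ `E_3(f,g,h) ≥ 0` on the Boolean lattice `Set κ` with a log-modular
probability weight (e.g. `bernoulliWeight p`). [this work] -/
theorem sahiE_three_nonneg_sharedSetCube_of_surplus [DistribLattice α'] [DistribLattice β']
    (hA : IsFKGMeasure wA) (hB : IsFKGMeasure wB) (hW0 : ∀ s, 0 ≤ W s) (hW1 : ∑ s, W s = 1)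
    (hWmod : ∀ s t, W s * W t = W (s ∩ t) * W (s ∪ t))
    (hf0 : ∀ c a, 0 ≤ f c a) (hfa : ∀ c, Monotone (f c)) (hfc : ∀ a, Monotone (fun c => f c a))
    (hg0 : ∀ c b, 0 ≤ g c b) (hgb : ∀ c, Monotone (g c)) (hgc : ∀ b, Monotone (fun c => g c b))
    (hh0 : ∀ c a b, 0 ≤ h c a b) (hhc : ∀ a b, Monotone (fun c => h c a b))
    (hha : ∀ c b, Monotone (fun a => h c a b)) (hhb : ∀ c a, Monotone (h c a))
    (hsur : ∀ c, EH wA wB W h * FC wA f c ≤ Ybar wA wB f h c) :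
    0 ≤ sahiE (fun q : α' × β' × Set κ => wA q.1 * wB q.2.1 * W q.2.2) 3
        ![fun q => f q.2.2 q.1, fun q => g q.2.2 q.2.1, fun q => h q.2.2 q.1 q.2.1] := by
  have hA0 := hA.nonneg
  have hB0 := hB.nonneg
  have hψ0 : ∀ c, psi wA wB W f h c = 0 := fun c =>
    (SahiSharedTwoPoint.rho_spec hA0 hB0 hW0 hf0 hh0 c).2.2.2.2.2.1 (hsur c)
  refine sahiE_three_nonneg_sharedSetCube_of_ratio hA hB hW0 hW1 hWmod hf0 hfa hfc hg0 hgb hgc hh0 hhc hha hhb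
    (rho wA wB W f h) (fun c => (SahiSharedTwoPoint.rho_spec hA0 hB0 hW0 hf0 hh0 c).1)
    (fun c => (SahiSharedTwoPoint.rho_spec hA0 hB0 hW0 hf0 hh0 c).2.1)
    (fun c c' hcc => SahiSharedTwoPoint.star hA0 hB0 hW0 hf0 hfc hh0 hhc hcc) ?_
  have hψ : ∀ c, rho wA wB W f h c * Ybar wA wB f h c - EH wA wB W h * FC wA f c = -psi wA wB W f h c := by
    intro c; unfold psi; ring
  simp only [hψ, hψ0, neg_zero, mul_zero, sum_const_zero, le_refl]

end SetCube

end SahiBox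

end Summit.CriticalPhenomena.PercolationContinuityZ3.Theorems
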